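import Literature.NumberTheory.Sieve.HeathBrownCubicTwistedCount
import HarnessLib

/-!
# Twisted lattice sums of `ℤ[∛2]`: equidistribution among the classes `mod q`

Sequel to `HeathBrownCubicTwistedCount` (`exists_twisted_sum_bound`: the sums of a NONTRIVIAL torus
character `ψ_{j,κ}` over the canonical generators `β ≡ a (mod q)` of norm `≤ t³` are
`O((1+|j|+|κ|) t^{8/3})`). Here the complementary statement for ALL `j, κ` (including the trivial
torus character and the non-integral unit frequencies `κ = k + (ju + t_χ)/2π` coming from a
character `χ mod q` with `χ(ε₀) = e^{it_χ} ≠ 1`, Heath-Brown (9.2)):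

* `exists_twisted_sum_approx` — ONE absolute `C` such that for all `j, κ, q ≥ 1, t ≥ 1` there is a
  main term `R ∈ ℂ` NOT depending on the class `a` with
  `‖∑_{v ∈ T(a)} ψ_{j,κ}(embW v̂) − R‖ ≤ C (1+|j|+|κ|) t^{8/3}` for every class `a` (the `M²` cells of
  the proof of `exists_twisted_sum_bound` have class-independent main terms `ψ_c · vol · (t/q)³`);
* `exists_twisted_sum_sub_bound` — hence two classes `a, a' (mod q)` give sums differing by
  `O((1+|j|+|κ|) t^{8/3})`; with `∑_α χ(α) = 0` for `χ ≠ χ₀` this is the cancellation in the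
  `ν₀ = χ`-aspect of Heath-Brown's `ν = ν₀ν₁^jν₂^k` needed for T. Mitsui's prime number theorem with
  Grössencharakteren (Jap. J. Math. 26 (1956), Lemma 5) = Heath-Brown's Lemma 9.4.

Everything is PROVED; no definitions, no named facts.

## References

* D. R. Heath-Brown, *Primes represented by `x³ + 2y³`*, Acta Math. 186 (2001), §9 (9.2), Lemma 9.4.
  [cite: HeathBrownActa2001, §9 Lemma 9.4]
* T. Mitsui, *Generalized prime number theorem*, Jap. J. Math. 26 (1956), 1–42, Lemma 5. [cite: Mitsui1956, Lemma 5]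
* D. A. Marcus, *Number Fields*, 2nd ed., Springer 2018, Ch. 6, Lemma 2. [cite: Marcus2018, Ch. 6, Lemma 2]

## Mathlib / tree search

Tree: `HeathBrownCubicTwistedCount` (`cell_estimates`, `twisted_endgame`, `exists_uniform_sectorIoc_count`,
`card_cong_eq`, `cellIdx_*`, `charRef`, `smul_fundRegion_subset`, `isBounded_image_fundRegion`). Mathlib:
`ZSpan.setFinite_inter`, `Finset.sum_fiberwise_of_maps_to`.
-/

noncomputable section

open Complex Set Metric MeasureTheory Module Submodule
open scoped NNReal Pointwise

namespace Literature.NumberTheory.Sieve.CubicSieve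

/-- **Approximation of the twisted class sums by a class-independent main term.** There is an
absolute `C` such that for all `j, κ, q ≥ 1, t ≥ 1` there is `R ∈ ℂ` (depending on these only) with
`‖∑_{v ∈ T(a)} ψ_{j,κ}(embW v̂) − R‖ ≤ C(1+|j|+|κ|) t^{8/3}` for EVERY class `a mod q` — the main
terms of the `M²` cells do not depend on the class. (For nontrivial `ψ` one may take `R = 0`:
`exists_twisted_sum_bound`.) [cite: HeathBrownActa2001, §9 Lemma 9.4 (input); Marcus2018, Ch. 6, Lemma 2] -/
theorem exists_twisted_sum_approx :
    ∃ C : ℝ, ∀ (j : ℤ) (κ : ℝ) (q : ℕ), 0 < q → ∀ (t : ℝ), 1 ≤ t → ∃ R : ℂ,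
      ∀ (a : ℤ × ℤ × ℤ) (T : Finset (ℤ × ℤ × ℤ)),
        (∀ v, v ∈ T ↔ CongMod q a v ∧
          embW (castVec v) ∈ t • sectorIoc ((0 : ℝ), -Real.pi) (1, Real.pi)) →
        ‖∑ v ∈ T, charW j κ (embW (castVec v)) - R‖ ≤ C * (1 + |(j : ℝ)| + |κ|) * t ^ (8 / 3 : ℝ) := by
  classical
  obtain ⟨C₁, hC₁⟩ := exists_uniform_sectorIoc_count
  set C₁' : ℝ := max C₁ 0 with hC₁'
  have hC₁'0 : 0 ≤ C₁' := le_max_right _ _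
  have hC₁le : C₁ ≤ C₁' := le_max_left _ _
  set covol : ℝ := volume.real (ZSpan.fundamentalDomain basisW) with hcovol
  set F : Set (ℝ × ℂ) := sectorIoc ((0 : ℝ), -Real.pi) (1, Real.pi) with hF
  set VF : ℝ := volume.real (sector ((0 : ℝ), -Real.pi) (1, Real.pi)) / covol with hVF
  have hVF0 : 0 ≤ VF := div_nonneg measureReal_nonneg measureReal_nonneg
  set K₀ : ℝ := VF + C₁' with hK₀
  have hK₀0 : 0 ≤ K₀ := add_nonneg hVF0 hC₁'0
  refine ⟨2 * Real.pi * K₀ + 30 * C₁' + K₀, ?_⟩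
  intro j κ q hq t ht
  have ht0 : 0 < t := by linarith
  have hqr : (0 : ℝ) < q := by exact_mod_cast hq
  have hq1 : (1 : ℝ) ≤ q := by exact_mod_cast hq
  have hFbox : ((0 : ℝ), -Real.pi) ≤ ((1 : ℝ), Real.pi) := by
    rw [Prod.le_def]; exact ⟨zero_le_one, by linarith [Real.pi_pos]⟩
  set J : ℝ := |(j : ℝ)| + |κ| with hJ
  have hJ0 : 0 ≤ J := by positivity
  set s : ℝ := t ^ ((1 : ℝ) / 3) with hs
  have hs1 : 1 ≤ s := Real.one_le_rpow ht (by norm_num)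
  have hs0 : 0 < s := by linarith
  have hs3 : s ^ 3 = t := by
    rw [hs, ← Real.rpow_natCast, ← Real.rpow_mul ht0.le]; norm_num
  have ht83 : t ^ (8 / 3 : ℝ) = s ^ 8 := by
    rw [hs, ← Real.rpow_natCast, ← Real.rpow_mul ht0.le]; norm_num
  rw [ht83]
  have h1J : 1 ≤ (1 + J) * s ^ 8 := by nlinarith [one_le_pow₀ (n := 8) hs1]
  have hCK : K₀ ≤ 2 * Real.pi * K₀ + 30 * C₁' + K₀ := by nlinarith [Real.pi_pos]
  set τ : ℝ := t / q with hτ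
  have hτ0 : 0 < τ := div_pos ht0 hqr
  -- the grid (depends on `j, κ, t` only)
  set M : ℕ := ⌈s⌉₊ + j.natAbs + ⌈|κ|⌉₊ + 1 with hM
  have hM0 : 0 < M := by omega
  have hMr : (0 : ℝ) < M := by exact_mod_cast hM0
  have hjabs : ((j.natAbs : ℕ) : ℝ) = |(j : ℝ)| := by rw [Nat.cast_natAbs, Int.cast_abs]
  have hsM : s ≤ M := by
    rw [hM]; push_cast
    have h1 := Nat.le_ceil s
    have h2 : (0 : ℝ) ≤ (j.natAbs : ℝ) := by positivity
    have h3 : (0 : ℝ) ≤ (⌈|κ|⌉₊ : ℝ) := by positivity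
    linarith
  have hMle : (M : ℝ) ≤ s + J + 3 := by
    rw [hM, hJ]; push_cast
    have h1 := (Nat.ceil_lt_add_one hs0.le).le
    have h2 := (Nat.ceil_lt_add_one (abs_nonneg κ)).le
    linarith
  set P : Finset (ℕ × ℕ) := Finset.range M ×ˢ Finset.range M with hP
  set ψref : ℕ × ℕ → ℂ := fun p ↦
    charRef j κ (((p.2 : ℝ) + 1) / M) (-Real.pi + 2 * Real.pi * (p.1 + 1) / M) with hψref
  set V : ℝ := volume.real (sector (cellLo M 0 0) (cellHi M 0 0)) / covol with hV
  set ω : ℝ := 2 * Real.pi * J / M with hω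
  -- the main term: `0` in the trivial-bound regimes, else `(∑ ψref) V τ³`
  refine ⟨if t < q ∨ s ^ 2 < J then 0 else (∑ p ∈ P, ψref p) * (V * τ ^ 3 : ℝ), ?_⟩
  intro a T hT
  set c : ℝ × ℂ := (-(1 / (q : ℝ))) • embW (castVec a) with hc
  have hcardT : T.card = Nat.card ↥(((fun w : ℝ × ℂ ↦ τ • w + c) '' F) ∩
      (span ℤ (Set.range basisW) : Set (ℝ × ℂ))) := by
    rw [← card_cong_eq q hq a t F, ← Nat.card_eq_finsetCard]
    exact Nat.card_congr (Equiv.subtypeEquivRight (fun v ↦ hT v))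
  have htriv : ‖∑ v ∈ T, charW j κ (embW (castVec v))‖ ≤ T.card := by
    refine (norm_sum_le _ _).trans ?_
    simp [norm_charW]
  by_cases htq : t < q
  · rw [if_pos (Or.inl htq), sub_zero]
    have hτ1 : τ ≤ 1 := by rw [hτ, div_le_one hqr]; exact htq.le
    have hsub : (fun w : ℝ × ℂ ↦ τ • w + c) '' F ⊆ (fun w : ℝ × ℂ ↦ (1 : ℝ) • w + c) '' F := by
      rintro _ ⟨w, hw, rfl⟩
      exact ⟨τ • w, smul_fundRegion_subset hτ0 hτ1 (Set.smul_mem_smul_set hw), by simp⟩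
    have hfin := ZSpan.setFinite_inter basisW (isBounded_image_fundRegion 1 zero_le_one c)
    have hmono := Nat.card_mono hfin (Set.inter_subset_inter_left _ hsub)
    have h1 := hC₁ ((0 : ℝ), -Real.pi) (1, Real.pi) le_rfl hFbox le_rfl 1 le_rfl c
    rw [one_pow, one_pow, mul_one, mul_one] at h1
    have hN1 : (Nat.card ↥(((fun w : ℝ × ℂ ↦ (1 : ℝ) • w + c) '' F) ∩
        (span ℤ (Set.range basisW) : Set (ℝ × ℂ))) : ℝ) ≤ K₀ := by
      have := (abs_le.1 h1).2
      rw [hK₀]; linarith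
    calc ‖∑ v ∈ T, charW j κ (embW (castVec v))‖ ≤ T.card := htriv
      _ ≤ K₀ := by rw [hcardT]; exact le_trans (by exact_mod_cast hmono) hN1
      _ ≤ (2 * Real.pi * K₀ + 30 * C₁' + K₀) * 1 := by linarith
      _ ≤ (2 * Real.pi * K₀ + 30 * C₁' + K₀) * ((1 + J) * s ^ 8) := by gcongr
      _ = _ := by ring
  rw [not_lt] at htq
  have hτ1 : 1 ≤ τ := by rw [hτ, le_div_iff₀ hqr, one_mul]; exact htq
  have hτt : τ ≤ t := by rw [hτ]; exact div_le_self ht0.le hq1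
  have hτs : τ ≤ s ^ 3 := hs3 ▸ hτt
  have hTK : (T.card : ℝ) ≤ K₀ * τ ^ 3 := by
    have h1 := hC₁ ((0 : ℝ), -Real.pi) (1, Real.pi) le_rfl hFbox le_rfl τ hτ1 c
    have := (abs_le.1 h1).2
    rw [hcardT, hK₀]
    have hτ23 : τ ^ 2 ≤ τ ^ 3 := pow_le_pow_right₀ hτ1 (by norm_num)
    nlinarith [hC₁le, hτ23]
  have hT9 : (T.card : ℝ) ≤ K₀ * s ^ 9 := by
    refine hTK.trans ?_
    calc K₀ * τ ^ 3 ≤ K₀ * (s ^ 3) ^ 3 := by gcongr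
      _ = K₀ * s ^ 9 := by ring
  by_cases hJs : s ^ 2 < J
  · rw [if_pos (Or.inr hJs), sub_zero]
    have hs9 : s ^ 9 ≤ (1 + J) * s ^ 8 := by
      have hss : s ≤ s ^ 2 := by
        calc s = s * 1 := by ring
          _ ≤ s * s := by gcongr
          _ = s ^ 2 := by ring
      have : s ≤ 1 + J := by linarith
      calc s ^ 9 = s * s ^ 8 := by ring
        _ ≤ (1 + J) * s ^ 8 := by gcongr
    calc ‖∑ v ∈ T, charW j κ (embW (castVec v))‖ ≤ T.card := htriv
      _ ≤ K₀ * s ^ 9 := hT9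
      _ ≤ K₀ * ((1 + J) * s ^ 8) := by gcongr
      _ ≤ (2 * Real.pi * K₀ + 30 * C₁' + K₀) * ((1 + J) * s ^ 8) := by gcongr
      _ = _ := by ring
  rw [not_lt] at hJs
  rw [if_neg (not_or.2 ⟨not_lt.2 htq, not_lt.2 hJs⟩)]
  have hmaps : ∀ v ∈ T, cellIdx M (embW (castVec v)) ∈ P := by
    intro v hv
    have hw := ((hT v).1 hv).2
    have hpos := pos_of_mem_smul_fundRegion ht0 hw
    rw [Set.mem_smul_set_iff_inv_smul_mem₀ ht0.ne'] at hw
    have := cellIdx_mem hM0 hw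
    rwa [cellIdx_smul (inv_pos.2 ht0) hpos.1 hpos.2] at this
  have hdecomp : ∑ v ∈ T, charW j κ (embW (castVec v)) =
      ∑ p ∈ P, ∑ v ∈ T with cellIdx M (embW (castVec v)) = p, charW j κ (embW (castVec v)) :=
    (Finset.sum_fiberwise_of_maps_to hmaps _).symm
  have hcardsum : T.card = ∑ p ∈ P, (T.filter (fun v ↦ cellIdx M (embW (castVec v)) = p)).card :=
    Finset.card_eq_sum_card_fiberwise hmaps
  have hmain : ‖∑ v ∈ T, charW j κ (embW (castVec v)) - (∑ p ∈ P, ψref p) * (V * τ ^ 3 : ℝ)‖ ≤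
      ω * T.card + (M : ℝ) ^ 2 * (C₁' * τ ^ 2) := by
    rw [hdecomp, Finset.sum_mul, ← Finset.sum_sub_distrib]
    refine (norm_sum_le _ _).trans ?_
    have hle : ∀ p ∈ P, ‖∑ v ∈ T with cellIdx M (embW (castVec v)) = p, charW j κ (embW (castVec v)) -
        ψref p * (V * τ ^ 3 : ℝ)‖ ≤
        ω * (T.filter (fun v ↦ cellIdx M (embW (castVec v)) = p)).card + C₁' * τ ^ 2 := by
      rintro ⟨i, l⟩ hp
      have hp' := hp
      rw [hP, Finset.mem_product, Finset.mem_range, Finset.mem_range] at hp'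
      obtain ⟨hN, hS⟩ := cell_estimates hC₁ j κ hq a ht0 hT hM0 hp'.1 hp'.2 hτ1
      set Np := (T.filter (fun v ↦ cellIdx M (embW (castVec v)) = (i, l))).card
      have hsplit : ∑ v ∈ T with cellIdx M (embW (castVec v)) = (i, l), charW j κ (embW (castVec v)) -
          ψref (i, l) * (V * τ ^ 3 : ℝ) =
          (∑ v ∈ T with cellIdx M (embW (castVec v)) = (i, l), charW j κ (embW (castVec v)) -
            ψref (i, l) * (Np : ℂ)) + ψref (i, l) * ((Np : ℝ) - V * τ ^ 3 : ℝ) := by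
        push_cast; ring
      rw [hsplit]
      refine (norm_add_le _ _).trans (add_le_add hS ?_)
      rw [norm_mul, hψref, norm_charRef, one_mul, Complex.norm_real, Real.norm_eq_abs]
      exact hN
    refine (Finset.sum_le_sum hle).trans (le_of_eq ?_)
    rw [Finset.sum_add_distrib, ← Finset.mul_sum, Finset.sum_const, nsmul_eq_mul, hcardsum]
    push_cast
    rw [hP, Finset.card_product, Finset.card_range]
    push_cast; ring
  refine hmain.trans ?_
  rw [hω, show (1 : ℝ) + |(j : ℝ)| + |κ| = 1 + J by rw [hJ]; ring]
  exact twisted_endgame hK₀0 hC₁'0 hJ0 hs1 hJs hsM hMle hτs hτ0.le hT9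

/-- **Equidistribution of `ψ` among the classes `mod q`**: the twisted sums over two classes
`a, a' (mod q)` differ by `O((1+|j|+|κ|) t^{8/3})`, for ALL `j, κ` (no nontriviality needed) —
with `∑_{α} χ(α) = 0` for `χ ≠ χ₀` this gives the cancellation in the `ν₀`-aspect.
[cite: HeathBrownActa2001, §9 Lemma 9.4 (input)] -/
theorem exists_twisted_sum_sub_bound :
    ∃ C : ℝ, ∀ (j : ℤ) (κ : ℝ) (q : ℕ), 0 < q → ∀ (a a' : ℤ × ℤ × ℤ) (t : ℝ), 1 ≤ t →
      ∀ T T' : Finset (ℤ × ℤ × ℤ),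
        (∀ v, v ∈ T ↔ CongMod q a v ∧
          embW (castVec v) ∈ t • sectorIoc ((0 : ℝ), -Real.pi) (1, Real.pi)) →
        (∀ v, v ∈ T' ↔ CongMod q a' v ∧
          embW (castVec v) ∈ t • sectorIoc ((0 : ℝ), -Real.pi) (1, Real.pi)) →
        ‖∑ v ∈ T, charW j κ (embW (castVec v)) - ∑ v ∈ T', charW j κ (embW (castVec v))‖ ≤
          C * (1 + |(j : ℝ)| + |κ|) * t ^ (8 / 3 : ℝ) := by
  obtain ⟨C, hC⟩ := exists_twisted_sum_approx
  refine ⟨2 * C, fun j κ q hq a a' t ht T T' hT hT' ↦ ?_⟩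
  obtain ⟨R, hR⟩ := hC j κ q hq t ht
  have h1 := hR a T hT
  have h2 := hR a' T' hT'
  calc ‖∑ v ∈ T, charW j κ (embW (castVec v)) - ∑ v ∈ T', charW j κ (embW (castVec v))‖
      = ‖(∑ v ∈ T, charW j κ (embW (castVec v)) - R) - (∑ v ∈ T', charW j κ (embW (castVec v)) - R)‖ := by
        congr 1; ring
    _ ≤ ‖∑ v ∈ T, charW j κ (embW (castVec v)) - R‖ + ‖∑ v ∈ T', charW j κ (embW (castVec v)) - R‖ :=
        norm_sub_le _ _
    _ ≤ _ := by linarith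

end Literature.NumberTheory.Sieve.CubicSieve
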